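import Literature.NumberTheory.LocalFields.LocalFieldInvolutionNormIndexTwo   -- ★ B-typ04 `LocalFieldInvolutionNorm.exists_fixed_nonnorm_dichotomy`, `exists_eq_norm_mul_of_not_norm` (abstract `p`-adic field, involution)
import Literature.NumberTheory.LocalFields.EquivariantUnitRigidityNormed      -- ★ `isNonarchimedeanLocalField_of_normedField` (locally compact ultrametric normed field ⇒ `IsNonarchimedeanLocalField`)
import Literature.NumberTheory.Rogawski1990.CartanAlgebra                     -- ★ `cartanAlgebra`, `hermStar`, `mul_comm_of_mem_cartanAlgebra`, `hermStar_mem_cartanAlgebra`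
import Mathlib.Analysis.Normed.Unbundled.SpectralNorm
import Mathlib.Analysis.Normed.Module.FiniteDimension
import HarnessLib

/-!
# R90-TF · S4 «Ch. 13.1–2», (DICT) sub-brick (3), FILE 2 of 3 — THE NORM-INDEX LETTER FOR A FIELD CARTAN ALGEBRA: over a non-archimedean local field, the `⋆`-fixed units of a
# Cartan algebra `Z(γ)` which is a FIELD have at most two classes modulo `⋆`-norms (Rogawski 1990, §3.5 Prop. 3.5.2 (a) p. 29, §3.6 p. 31 type (3); Serre, *Local Fields*, XIV §2)

Cell `hodgecm-mathlib`, crux H413 (`stmt-HodgeConjecture-24833`, lane `--supports … --as helper`), route of record `HCCMUnconditional` (no route verbs; count-neutral).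
Programme R90-TF, section S4, dealer K2E2-plan (g7): (DICT) sub-brick (3) «CUBIC CARTAN: STABLE CLASS = CLASS» (`R90/STATUS.md` 2026-09-05T00:26:10Z, GO 00:33:17Z «(B) as a
SEPARATE file; export the local-field construction so (IDX) imports it»); seat K2E3-p27 (g3).  Sequel of FILE 1 ★-to-be `R90S4StableConjOfNormClassesLeTwo` (the odd-degree trick,
hypothesis `hNI`); FILE 3 `R90S4CubicCartanStableClass` composes both on `Gqs L v`.  THEOREMS ONLY — no `def`, no instance, no notation, no `sorry`; ★-only imports + Mathlib.

## THE MATHEMATICS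
`K` a non-archimedean local field of characteristic `0`, given as a complete, locally compact, ultrametric, non-trivially normed field (the shape of `E_w = w.adicCompletion L`:
Mathlib `instNormedFieldValuedAdicCompletion` + ★ `AdicCompletionLocalField`).  (§1) ANY finite-dimensional field extension `A ∕ K` is again a non-archimedean local field:
Mathlib's SPECTRAL NORM (`spectralNorm.nontriviallyNormedField K A`, the unique norm extending `‖·‖_K`; non-archimedean by `isNonarchimedean_spectralNorm`) makes `A` a normed
`K`-space, hence proper (`FiniteDimensional.proper`, `K` locally compact), hence an `IsNonarchimedeanLocalField` for the valuative relation of its norm (★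
`isNonarchimedeanLocalField_of_normedField`).  Consequently ★ B-typ04's abstract local norm-index theorem applies to every ring involution `τ ≠ id` of `A`:
**`exists_fixed_nonnorm_dichotomy_of_finiteDimensional`** (a `τ`-fixed non-norm `c` exists and `A^{τ,×} = N ⊔ c⁻¹N`) and **`exists_eq_norm_mul_of_not_norm_of_finiteDimensional`**
(two `τ`-fixed non-norms differ by a norm `z·τz`) — `[A^τ× : N(A^×)] = 2` EXACTLY [Serre XIV §2; Neukirch V (1.3)].  These two are the instance-free exports the (IDX) letter of the
(DICT) payer wants per factor of a Cartan algebra.  (§2) For `γ ∈ U(H)(K)` regular semisimple (`H` `σ`-hermitian invertible, `σ` an involution of `K`, `σ ≠ id`) whose Cartan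
algebra `Z(γ) ⊆ M_n(K)` (★ `cartanAlgebra`, commutative by ★ `mul_comm_of_mem_cartanAlgebra`) is a FIELD — type (3) of [Rogawski1990 §3.6] when `n = 3`: `Z(γ) = K₃·E` for a cubic
field `K₃ ∕ F` — the adjoint `⋆ = hermStar σ H` restricts to a ring involution `τ` of the field `Z(γ)` (`(ab)⋆ = b⋆a⋆ = a⋆b⋆`), `τ ≠ id` (it is `σ` on scalars), and §1 gives
**`normClasses_le_two_of_isField`**: two `⋆`-fixed units `x, y ∈ Z(γ)` which are not killed by a `⋆`-norm `t⋆t` (`t ∈ Z(γ)` invertible) satisfy `y = x·(t⋆t)` — the letter `hNI`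
of FILE 1, i.e. `|H¹(F, T)| = |K₃^× ∕ N(Z(γ)^×)| ≤ 2` for the torus `T = Z_U(γ)` [Prop. 3.5.2 (a)].

## CONTENTS
* §1 `exists_fixed_nonnorm_dichotomy_of_finiteDimensional`, `exists_eq_norm_mul_of_not_norm_of_finiteDimensional` (abstract `A ∕ K` finite, `A` a field, `τ` an involution `≠ id`).
* §2 `normClasses_le_two_of_isField` (the `hNI` letter of FILE 1 for a field Cartan algebra, any `n`).

HONEST LABEL: HC_CM is proved only modulo the 7 printed citations (2 remaining named inputs: hLiu418 = stmt-HodgeConjecture-24832, h413 = stmt-HodgeConjecture-24833) until rung 0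
closes.  Local algebra toward the (DICT) payer of (B2-S); discharges no named input; (W-NP) ∕ (1D-CT)_ns OPEN.  REL ≠ ★ ≠ BUILT.

## References
* [Rogawski1990] J. D. Rogawski, *Automorphic Representations of Unitary Groups in Three Variables*, Ann. of Math. Stud. 123 (1990), §3.5 Prop. 3.5.2 (a) p. 29 (`H¹(F,T) ≅ ⊕ Kᵢ^τ×∕N`),
  §3.6 p. 31 (type (3): `T = K₃¹`, one class), §3.8 p. 31.
* [Serre1979] J.-P. Serre, *Local Fields*, GTM 67 (1979), Ch. II §1–§2 (finite extensions of local fields), Ch. XIV §2 (local norm index).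
* [NeukirchANT1999] J. Neukirch, *Algebraic Number Theory* (1999), Ch. II (4.8)–(4.9) (unique extension of the absolute value), Ch. V (1.3).
-/

set_option autoImplicit false
set_option linter.dupNamespace false

noncomputable section

open scoped Matrix MatrixGroups
open Literature.NumberTheory.Rogawski1990 Literature.NumberTheory.LocalFields
open Literature.AlgebraicGeometry.ShimuraVarieties (unitaryGroup mem_unitaryGroup_iff)

namespace Summit.HodgeConjecture.HodgeConjecture.R90.S4

/-! ## §1 A finite extension of a non-archimedean local field is a non-archimedean local field: the two norm-index exports -/

section FiniteExtension

/-- **A finite-dimensional field extension `A` of a complete, locally compact, ultrametric non-trivially normed field `K` carries a non-archimedean-local-field structure**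
(Mathlib `IsNonarchimedeanLocalField`, for SOME valuative relation and topology — those of the spectral norm): `A` with `spectralNorm.nontriviallyNormedField K A` is
ultrametric (`isNonarchimedean_spectralNorm`), proper (`FiniteDimensional.proper`), hence ★ `isNonarchimedeanLocalField_of_normedField`.  Instance-free existential form, so
that purely algebraic consequences can be drawn without committing the caller to these instances. [cite: Serre1979, Ch. II §1 Prop. 1, §2 Prop. 3] [cite: NeukirchANT1999, Ch. II (4.8)] -/
theorem exists_isNonarchimedeanLocalField_of_finiteDimensional (K : Type) [NontriviallyNormedField K] [CompleteSpace K] [IsUltrametricDist K]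
    [LocallyCompactSpace K] (A : Type) [Field A] [Algebra K A] [FiniteDimensional K A] :
    ∃ (r : ValuativeRel A) (t : TopologicalSpace A), @IsNonarchimedeanLocalField A _ r t := by
  haveI : Algebra.IsAlgebraic K A := Algebra.IsAlgebraic.of_finite K A
  letI : NontriviallyNormedField A := spectralNorm.nontriviallyNormedField K A
  have hna : IsNonarchimedean (norm : A → ℝ) := fun x y => by
    change spectralNorm K A (x + y) ≤ max (spectralNorm K A x) (spectralNorm K A y)
    exact isNonarchimedean_spectralNorm x y
  haveI : IsUltrametricDist A := IsUltrametricDist.isUltrametricDist_of_isNonarchimedean_norm hna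
  letI : NormedSpace K A := spectralNorm.normedSpace K A
  haveI : ProperSpace A := FiniteDimensional.proper K A
  exact ⟨_, _, isNonarchimedeanLocalField_of_normedField A⟩

/-- **`[A^τ× : N(A^×)] = 2` for an involution of a finite extension of a local field — existence of a non-norm and the dichotomy.**  `K` a complete, locally compact,
ultrametric non-trivially normed field with `char K = 0`, `A ∕ K` a finite-dimensional field extension, `τ : A →+* A` an involution, `τ ≠ id`, `N z = z·τz`: there is a
`τ`-fixed `c ≠ 0` which is not a norm, and every `τ`-fixed `s ≠ 0` is `N z` or satisfies `c·s = N z` (★ B-typ04 `LocalFieldInvolutionNorm.exists_fixed_nonnorm_dichotomy` on the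
local-field structure of `exists_isNonarchimedeanLocalField_of_finiteDimensional`).
[cite: Serre1979, Ch. XIV §2; Ch. V §3 Prop. 5 Cor. 3] [cite: NeukirchANT1999, Ch. V (1.3)] [cite: Rogawski1990, §3.5 Prop. 3.5.2 (a) p. 29] -/
theorem exists_fixed_nonnorm_dichotomy_of_finiteDimensional (K : Type) [NontriviallyNormedField K] [CompleteSpace K] [IsUltrametricDist K]
    [LocallyCompactSpace K] [CharZero K] {A : Type} [Field A] [Algebra K A] [FiniteDimensional K A]
    (τ : A →+* A) (hτ : ∀ a, τ (τ a) = a) (hτ1 : τ ≠ RingHom.id A) :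
    ∃ c : A, τ c = c ∧ c ≠ 0 ∧ (∀ z : A, z * τ z ≠ c) ∧
      ∀ s : A, τ s = s → s ≠ 0 → (∃ z : A, z * τ z = s) ∨ ∃ z : A, z * τ z = c * s := by
  obtain ⟨r, t, hloc⟩ := exists_isNonarchimedeanLocalField_of_finiteDimensional K A
  letI := r
  letI := t
  haveI := hloc
  haveI : CharZero A := charZero_of_injective_algebraMap (algebraMap K A).injective
  exact LocalFieldInvolutionNorm.exists_fixed_nonnorm_dichotomy τ hτ hτ1

/-- **Two `τ`-fixed non-norms differ by a norm** — `[A^τ× : N(A^×)] ≤ 2` for an involution `τ ≠ id` of a finite-dimensional field extension `A` of a local field `K` of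
characteristic `0` (★ B-typ04 `LocalFieldInvolutionNorm.exists_eq_norm_mul_of_not_norm` on the local-field structure of `exists_isNonarchimedeanLocalField_of_finiteDimensional`).
[cite: Serre1979, Ch. XIV §2; Ch. V §3 Prop. 5 Cor. 3] [cite: NeukirchANT1999, Ch. V (1.3)] [cite: Rogawski1990, §3.5 Prop. 3.5.2 (a) p. 29] -/
theorem exists_eq_norm_mul_of_not_norm_of_finiteDimensional (K : Type) [NontriviallyNormedField K] [CompleteSpace K] [IsUltrametricDist K]
    [LocallyCompactSpace K] [CharZero K] {A : Type} [Field A] [Algebra K A] [FiniteDimensional K A]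
    (τ : A →+* A) (hτ : ∀ a, τ (τ a) = a) (hτ1 : τ ≠ RingHom.id A)
    {s t : A} (hτs : τ s = s) (hs0 : s ≠ 0) (hsn : ∀ z : A, z * τ z ≠ s)
    (hτt : τ t = t) (ht0 : t ≠ 0) (htn : ∀ z : A, z * τ z ≠ t) :
    ∃ z : A, t = z * τ z * s := by
  obtain ⟨r, tp, hloc⟩ := exists_isNonarchimedeanLocalField_of_finiteDimensional K A
  letI := r
  letI := tp
  haveI := hloc
  haveI : CharZero A := charZero_of_injective_algebraMap (algebraMap K A).injective
  exact LocalFieldInvolutionNorm.exists_eq_norm_mul_of_not_norm τ hτ hτ1 hτs hs0 hsn hτt ht0 htn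

end FiniteExtension

/-! ## §2 The `hNI` letter for a FIELD Cartan algebra over a local field -/

section Cartan

variable {K : Type} [NontriviallyNormedField K] [CompleteSpace K] [IsUltrametricDist K] [LocallyCompactSpace K] [CharZero K]
  (σ : K →+* K) {n : Type} [Fintype n] [DecidableEq n] [Nonempty n] {H : Matrix n n K}

omit [CompleteSpace K] [IsUltrametricDist K] [LocallyCompactSpace K] [CharZero K] [Nonempty n] in
/-- Bookkeeping in a commutative `⋆`-stable algebra: for an invertible `u` with `u, u⋆ ∈ Z`, `u·u⋆·((u⁻¹)⋆·u⁻¹) = 1`. [folklore] -/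
private theorem mul_hermStar_mul_inv_eq_one (hH : IsUnit H.det) {Z : Set (Matrix n n K)}
    (hcomm : ∀ a b : Matrix n n K, a ∈ Z → b ∈ Z → a * b = b * a) (hstar : ∀ a : Matrix n n K, a ∈ Z → hermStar σ H a ∈ Z)
    (u : GL n K) (hu : (u : Matrix n n K) ∈ Z) (hui : ((u⁻¹ : GL n K) : Matrix n n K) ∈ Z) :
    (u : Matrix n n K) * hermStar σ H (u : Matrix n n K) * (hermStar σ H ((u⁻¹ : GL n K) : Matrix n n K) * ((u⁻¹ : GL n K) : Matrix n n K)) = 1 := by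
  have h1 : (u : Matrix n n K) * ((u⁻¹ : GL n K) : Matrix n n K) = 1 := by rw [← Units.val_mul, mul_inv_cancel, Units.val_one]
  have h2 : ((u⁻¹ : GL n K) : Matrix n n K) * (u : Matrix n n K) = 1 := by rw [← Units.val_mul, inv_mul_cancel, Units.val_one]
  calc (u : Matrix n n K) * hermStar σ H (u : Matrix n n K) * (hermStar σ H ((u⁻¹ : GL n K) : Matrix n n K) * ((u⁻¹ : GL n K) : Matrix n n K))
      = hermStar σ H (u : Matrix n n K) * (hermStar σ H ((u⁻¹ : GL n K) : Matrix n n K) * ((u : Matrix n n K) * ((u⁻¹ : GL n K) : Matrix n n K))) := by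
        rw [hcomm _ _ hu (hstar _ hu), Matrix.mul_assoc, ← Matrix.mul_assoc (u : Matrix n n K), hcomm _ _ hu (hstar _ hui), Matrix.mul_assoc]
    _ = 1 := by rw [h1, Matrix.mul_one, ← hermStar_mul σ H hH, h2, hermStar_one σ H hH]

/-- **THE `hNI` LETTER FOR A FIELD CARTAN ALGEBRA.**  `K` a complete, locally compact, ultrametric non-trivially normed field of characteristic `0` (e.g. `E_w`), `σ` an
involution of `K` with `σ ≠ id`, `H ∈ M_n(K)` `σ`-hermitian invertible, `γ ∈ U(H)(K)` regular semisimple whose Cartan algebra `Z(γ)` (★ `cartanAlgebra`) is a FIELD.  Then any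
two `⋆`-fixed units `x, y ∈ Z(γ)` which are NOT killed by a `⋆`-norm (`¬ ∃ t ∈ Z(γ)` invertible with `x·(t⋆t) = 1`) satisfy `y = x·(t⋆t)` for some invertible `t ∈ Z(γ)`: the
restriction `τ` of `⋆` to the field `Z(γ)` is a ring involution, `≠ id` on scalars, and §1 `exists_eq_norm_mul_of_not_norm_of_finiteDimensional` applies; «killed by a norm» ⟺ «is a
norm» in the commutative `Z(γ)` (`x·(t⋆t) = 1 ⟺ x = (t⁻¹)⋆·t⁻¹`).  For `n = 3` this is `|𝔇(T∕F)| ≤ |H¹(F,T)| = 2` at a type-(3) torus [§3.6].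
[cite: Rogawski1990, §3.5 Prop. 3.5.2 (a) p. 29; §3.6 p. 31] [cite: Serre1979, Ch. XIV §2] -/
theorem normClasses_le_two_of_isField (hH : IsUnit H.det) (hσ : ∀ r : K, σ (σ r) = r) (hHh : (H.map σ)ᵀ = H) (hσ1 : ∃ r : K, σ r ≠ r)
    {γ : GL n K} (hγ : γ ∈ unitaryGroup σ H) (hsep : (γ : Matrix n n K).charpoly.Separable)
    (hfield : IsField ↥(cartanAlgebra (γ : Matrix n n K))) :
    ∀ x y : Matrix n n K,
      x ∈ cartanAlgebra (γ : Matrix n n K) → y ∈ cartanAlgebra (γ : Matrix n n K) →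
      hermStar σ H x = x → hermStar σ H y = y → IsUnit x.det → IsUnit y.det →
      (¬ ∃ t : GL n K, (t : Matrix n n K) ∈ cartanAlgebra (γ : Matrix n n K) ∧ x * (hermStar σ H t * t) = 1) →
      (¬ ∃ t : GL n K, (t : Matrix n n K) ∈ cartanAlgebra (γ : Matrix n n K) ∧ y * (hermStar σ H t * t) = 1) →
      ∃ t : GL n K, (t : Matrix n n K) ∈ cartanAlgebra (γ : Matrix n n K) ∧ y = x * (hermStar σ H t * t) := by
  intro x y hx hy hxs hys hxu hyu hxn hyn
  set Z := cartanAlgebra (γ : Matrix n n K) with hZ_def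
  have hcomm : ∀ a b : Matrix n n K, a ∈ Z → b ∈ Z → a * b = b * a := fun a b ha hb => mul_comm_of_mem_cartanAlgebra hsep ha hb
  have hstar : ∀ a : Matrix n n K, a ∈ Z → hermStar σ H a ∈ Z := fun a ha => hermStar_mem_cartanAlgebra σ H hH hγ ha
  letI : Field ↥Z := hfield.toField
  haveI : FiniteDimensional K ↥Z := FiniteDimensional.of_injective Z.val.toLinearMap Subtype.val_injective
  -- the involution `τ = ⋆|_{Z(γ)}` as a ring homomorphism of the field `Z(γ)`
  let τ : ↥Z →+* ↥Z :=
    { toFun := fun a => ⟨hermStar σ H (a : Matrix n n K), hstar _ a.2⟩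
      map_one' := Subtype.ext (hermStar_one σ H hH)
      map_mul' := fun a b => Subtype.ext (by
        change hermStar σ H ((a : Matrix n n K) * (b : Matrix n n K)) = hermStar σ H (a : Matrix n n K) * hermStar σ H (b : Matrix n n K)
        rw [hermStar_mul σ H hH, hcomm _ _ (hstar _ b.2) (hstar _ a.2)])
      map_zero' := Subtype.ext (by
        change hermStar σ H (0 : Matrix n n K) = 0
        rw [← zero_smul K (0 : Matrix n n K), hermStar_smul, map_zero, zero_smul, zero_smul])
      map_add' := fun a b => Subtype.ext (hermStar_add σ H _ _) }
  have hτapply : ∀ a : ↥Z, ((τ a : ↥Z) : Matrix n n K) = hermStar σ H (a : Matrix n n K) := fun _ => rfl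
  have hτ : ∀ a, τ (τ a) = a := fun a => Subtype.ext (by rw [hτapply, hτapply, hermStar_hermStar σ H hH hσ hHh])
  have hτ1 : τ ≠ RingHom.id ↥Z := by
    obtain ⟨k, hk⟩ := hσ1
    intro h
    have hk' : τ (algebraMap K ↥Z k) = algebraMap K ↥Z k := by rw [h]; rfl
    have hval : ((τ (algebraMap K ↥Z k) : ↥Z) : Matrix n n K) = algebraMap K (Matrix n n K) (σ k) := by
      rw [hτapply, Subalgebra.coe_algebraMap, Algebra.algebraMap_eq_smul_one, Algebra.algebraMap_eq_smul_one, hermStar_smul, hermStar_one σ H hH]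
    rw [hk', Subalgebra.coe_algebraMap] at hval
    exact hk ((algebraMap K (Matrix n n K)).injective hval).symm
  -- «not killed by a norm» in `Z(γ)` ⇒ «not a norm `z·τz`» in the field `Z(γ)`
  have hnotnorm : ∀ {a : Matrix n n K} (ha : a ∈ Z), IsUnit a.det →
      (¬ ∃ t : GL n K, (t : Matrix n n K) ∈ Z ∧ a * (hermStar σ H t * t) = 1) → ∀ z : ↥Z, z * τ z ≠ ⟨a, ha⟩ := by
    intro a ha hau han z hz
    apply han
    have hzval : (z : Matrix n n K) * hermStar σ H (z : Matrix n n K) = a := congrArg Subtype.val hz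
    have hdz : IsUnit (z : Matrix n n K).det := by
      have hd := congrArg Matrix.det hzval
      rw [Matrix.det_mul] at hd
      rw [← hd] at hau
      exact isUnit_of_mul_isUnit_left hau
    set u : GL n K := ((Matrix.isUnit_iff_isUnit_det _).2 hdz).unit with hu_def
    have huval : (u : Matrix n n K) = z := IsUnit.unit_spec _
    have huZ : (u : Matrix n n K) ∈ Z := by rw [huval]; exact z.2
    have huiZ : ((u⁻¹ : GL n K) : Matrix n n K) ∈ Z := by
      rw [hZ_def, mem_cartanAlgebra_iff]
      have hc : Commute (u : Matrix n n K) (γ : Matrix n n K) := mem_cartanAlgebra_iff.1 huZ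
      exact hc.units_inv_left
    refine ⟨u⁻¹, huiZ, ?_⟩
    rw [← hzval, ← huval]
    exact mul_hermStar_mul_inv_eq_one σ hH hcomm hstar u huZ huiZ
  have hx0 : (⟨x, hx⟩ : ↥Z) ≠ 0 := by
    intro h0
    have h0' : x = 0 := congrArg Subtype.val h0
    rw [h0', Matrix.det_zero] at hxu
    exact not_isUnit_zero hxu
  have hy0 : (⟨y, hy⟩ : ↥Z) ≠ 0 := by
    intro h0
    have h0' : y = 0 := congrArg Subtype.val h0
    rw [h0', Matrix.det_zero] at hyu
    exact not_isUnit_zero hyu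
  obtain ⟨z, hz⟩ := exists_eq_norm_mul_of_not_norm_of_finiteDimensional K τ hτ hτ1
    (s := ⟨x, hx⟩) (t := ⟨y, hy⟩) (Subtype.ext hxs) hx0 (hnotnorm hx hxu hxn) (Subtype.ext hys) hy0 (hnotnorm hy hyu hyn)
  -- `y = z·z⋆·x` in `M_n(K)`
  have hyval : y = (z : Matrix n n K) * hermStar σ H (z : Matrix n n K) * x := congrArg Subtype.val hz
  have hdz : IsUnit (z : Matrix n n K).det := by
    have hd := congrArg Matrix.det hyval
    rw [Matrix.det_mul, Matrix.det_mul, mul_assoc] at hd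
    rw [hd] at hyu
    exact isUnit_of_mul_isUnit_left hyu
  set u : GL n K := ((Matrix.isUnit_iff_isUnit_det _).2 hdz).unit with hu_def
  have huval : (u : Matrix n n K) = z := IsUnit.unit_spec _
  refine ⟨u, by rw [huval]; exact z.2, ?_⟩
  rw [hyval, huval, hcomm _ _ (Z.mul_mem z.2 (hstar _ z.2)) hx, hcomm _ _ z.2 (hstar _ z.2)]

end Cartan

end Summit.HodgeConjecture.HodgeConjecture.R90.S4

end
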